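import Mathlib.Tactic.IntervalCases
import Literature.Computability.AlgebraicComplexity.MignonRessayreBound
import Literature.Computability.AlgebraicComplexity.StandardFamiliesProofs
import HarnessLib

/-!
# The Mignon–Ressayre bound over any field of characteristic zero, and what the
  characteristic-`≠ 2` citation actually supports

Companion of `PermanentVsDeterminant.lean` and `MignonRessayreBound.lean`.

## Why this file exists (a mis-cited fact)

`PermanentVsDeterminant.sq_le_two_mul_determinantalComplexity_perPoly` (like its wave-0 twin
`Literature.Computability.Complexity.sq_le_two_mul_determinantalComplexity_per`) asserts
`n ^ 2 ≤ 2 · dc(PER_n)` for `n ≥ 3` over **every** field of characteristic `≠ 2`, citing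
Mignon–Ressayre 2004 for characteristic `0` and "Cai–Chen–Li 2010, Thm. 1" for characteristic
`≠ 2`. The second citation does not support the statement. Cai–Chen–Li (Comput. Complexity 19
(2010) 37–56, full text read) prove, in positive characteristic, only their Theorem 2.3: for a prime
`p > 2` and `n > 2` with `p ∣ n + 1` (`p ≠ 23`), resp. `n > 1` with `p ∣ n + 2` (`p ≠ 3, 5`), an
explicit `(n+1) × (n+1)` zero `X₀ = Mⁿ_v` of `per_{n+1}` over `𝔽_p` with Hessian rank
`≥ (n-2)(n-3)`; with the chain-rule step of their §2.1 this gives `(n-2)(n-3) ≤ 2 · dc(per_{n+1})`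
for infinitely many `n` per odd prime (their Corollary 2.4, whose printed form `dc(per_n) ≥
(n-2)(n-3)/2` is moreover off by one index). For `2 < p < n` the bound `n² / 2` for all `n` is not
in the literature (loc. cit., end of §4: "We believe that probably most matrices `X`, where
`per(X) = 0`, will work ... The problem is rather how to prove this."). The Mignon–Ressayre zero
`y₀ = J - n·E₁₁` has Hessian `(n-3)! · H'` with `H'` invertible iff `(n-1)(n-2) ≠ 0` in `k`
(Landsberg 2017, §6.4.6), so it settles exactly characteristic `0` (and characteristic `p ≥ n`).
No new named fact is minted for the Cai–Chen–Li statement here (D-0026); the mis-cited fact was left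
untouched by this file (nothing in the tree consumed it). **Update (verdict clean-up, 2026-08-15):**
`sq_le_two_mul_determinantalComplexity_perPoly` has since been RESTATED in place in
`PermanentVsDeterminant.lean` with the sharpened hypothesis `ringChar k = 0` (same name, same shape
`3 ≤ n`); its discharge `sq_le_two_mul_determinantalComplexity_perPoly_holds` is proved below from
`sq_le_two_mul_determinantalComplexity_perPoly_charZero_holds` (it cannot sit next to the fact: the
Hessian argument of `MignonRessayreBound.lean` imports `PermanentVsDeterminant.lean`).

## Contents

* `sq_le_two_mul_determinantalComplexity_perPoly_charZero`: the corrected statement — over a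
  field of characteristic `0`, `n ^ 2 ≤ 2 · dc(PER_n)` for every `n` ("For any field of
  characteristic `0`, `dc(per_n) ≥ n²/2`": Mignon–Ressayre 2004, Thm. 1.1, quoted in this form as
  Cai–Chen–Li 2010, Thm. 2.2, and Landsberg 2017, Thm. 6.4.6.4) — together with its DISCHARGE
  `sq_le_two_mul_determinantalComplexity_perPoly_charZero_holds`: for `n ≥ 3` this is
  `sq_le_two_mul_of_hasDetRepr_perPoly` of `MignonRessayreBound.lean` (the Hessian argument at
  `y₀`, formalised there over any characteristic-`0` field) at the attained representation
  (`hasDetRepr_determinantalComplexity_holds`); for `n ≤ 2` it is the degree bound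
  `n = deg PER_n ≤ dc(PER_n)`.
* `sq_le_two_mul_determinantalComplexity_perPoly_holds`: DISCHARGE of the restated
  `PermanentVsDeterminant.sq_le_two_mul_determinantalComplexity_perPoly` (`ringChar k = 0`, `n ≥ 3`)
  from the previous item (`ringChar k = 0 ⇒ CharP k 0 ⇒ CharZero k`).
* `card_le_determinantalComplexity_perPoly`: the degree bound `n = deg PER_n ≤ dc(PER_n)`
  (`totalDegree_perPoly_holds` of `StandardFamiliesProofs.lean` and
  `totalDegree_le_determinantalComplexity_holds`).

## References

* T. Mignon, N. Ressayre, *A quadratic bound for the determinant and permanent problem*,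
  Int. Math. Res. Not. 2004, no. 79, 4241–4253, Thm. 1.1 (key `MignonRessayre2004`).
* J.-Y. Cai, X. Chen, D. Li, *Quadratic lower bound for permanent vs. determinant in any
  characteristic*, Comput. Complexity 19 (2010) 37–56, Thm. 2.2, Thm. 2.3, Cor. 2.4, §2.1, §4
  (key `CaiChenLi2010`).
* J. M. Landsberg, *Geometry and Complexity Theory*, CUP 2017, §6.4.6, Thm. 6.4.6.4
  (key `LandsbergGCT2017`).
-/

noncomputable section

open MvPolynomial

namespace Literature.Computability.AlgebraicComplexity

/-! ### The degree of the permanent and the trivial bound `n ≤ dc(PER_n)` -/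

section Degree

/-- The degree bound for the permanent: `card n = deg PER_n ≤ dc(PER_n)` over a nontrivial
commutative ring (Mignon–Ressayre 2004, §1: `deg f ≤ dc f`, with Valiant universality making the
infimum attained, `totalDegree_le_determinantalComplexity_holds`). [cite: MignonRessayre2004, §1] -/
theorem card_le_determinantalComplexity_perPoly (n : Type*) [Fintype n] [DecidableEq n]
    (k : Type*) [CommRing k] [Nontrivial k] :
    Fintype.card n ≤ determinantalComplexity (perPoly n k) := by
  calc Fintype.card n = (perPoly n k).totalDegree := (totalDegree_perPoly_holds (n := n) (k := k)).symm
    _ ≤ determinantalComplexity (perPoly n k) := totalDegree_le_determinantalComplexity_holds _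

end Degree

/-! ### The corrected statement and its discharge -/

section CharZero

/-- **Mignon–Ressayre lower bound in characteristic zero** (the corrected form of
`sq_le_two_mul_determinantalComplexity_perPoly`; see the module docstring for the discrepancy
with the characteristic-`≠ 2` version). Over a field `k` of characteristic `0`,
`n ^ 2 ≤ 2 · dc(PER_n)` for every `n`, i.e. "For any field of characteristic `0`,
`dc(per_n) ≥ n² / 2`" (Mignon–Ressayre 2004, Thm. 1.1; quoted in this form as Cai–Chen–Li 2010,
Thm. 2.2, and Landsberg 2017, Thm. 6.4.6.4). For `n ≤ 2` this is the degree bound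
`deg f ≤ dc f`; for `n ≥ 3` it is the Hessian argument at the zero `y₀ = J - n·E₁₁` of `per_n`.
Here `dc = Literature.Computability.AlgebraicComplexity.determinantalComplexity`, an `sInf` over
`ℕ` that is attained (`hasDetRepr_determinantalComplexity`, from Valiant universality), so no
junk value intervenes. [cite: MignonRessayre2004, Thm. 1.1] -/
def sq_le_two_mul_determinantalComplexity_perPoly_charZero : Prop :=
  ∀ (k : Type*) [Field k] [CharZero k] (n : ℕ),
    n ^ 2 ≤ 2 * Literature.Computability.AlgebraicComplexity.determinantalComplexity
      (Literature.Computability.AlgebraicComplexity.perPoly (Fin n) k)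

/-- **Discharge of `sq_le_two_mul_determinantalComplexity_perPoly_charZero`** (Mignon–Ressayre
2004, Thm. 1.1; Landsberg 2017, Thm. 6.4.6.4): for `n ≥ 3` write `n = m + 3` and apply the core
inequality `sq_le_two_mul_of_hasDetRepr_perPoly` (Hessian of `per_n` at the Mignon–Ressayre point,
valid over any field of characteristic `0`) to the representation of size `dc(PER_n)`, which exists
by Valiant universality (`hasDetRepr_determinantalComplexity_holds`); for `n ≤ 2`,
`n² ≤ 2n ≤ 2 · dc(PER_n)` by the degree bound. [cite: MignonRessayre2004, Thm. 1.1] -/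
theorem sq_le_two_mul_determinantalComplexity_perPoly_charZero_holds :
    sq_le_two_mul_determinantalComplexity_perPoly_charZero := by
  intro k _ _ n
  by_cases hn : 3 ≤ n
  · obtain ⟨m, rfl⟩ : ∃ m, n = m + 3 := ⟨n - 3, by omega⟩
    exact sq_le_two_mul_of_hasDetRepr_perPoly (hasDetRepr_determinantalComplexity_holds _)
  · have hdeg := card_le_determinantalComplexity_perPoly (Fin n) k
    rw [Fintype.card_fin] at hdeg
    interval_cases n <;> omega

/-- The characteristic-`0` bound implies the (mis-cited) characteristic-`≠ 2` fact restricted to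
characteristic `0`, and in particular re-derives the `ℂ` specialisation
`sq_le_two_mul_determinantalComplexity_perPoly_complex` (also discharged directly in
`MignonRessayreBound.lean`); `ℂ : Type` uses the universe-`0` instance of the polymorphic fact.
[cite: MignonRessayre2004, Thm. 1.1] -/
theorem sq_le_two_mul_determinantalComplexity_perPoly_complex_of_charZero
    (h : sq_le_two_mul_determinantalComplexity_perPoly_charZero.{0}) :
    sq_le_two_mul_determinantalComplexity_perPoly_complex :=
  fun {n} _ => h ℂ n

/-- **Discharge of the restated `sq_le_two_mul_determinantalComplexity_perPoly`**
(`PermanentVsDeterminant.lean`; Mignon–Ressayre 2004, Thm. 1.1; Landsberg 2017, Thm. 6.4.6.4): over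
a field `k` with `ringChar k = 0` and for `n ≥ 3`, `n ^ 2 ≤ 2 · dc(PER_n)`. From `ringChar k = 0`
we get `CharP k 0`, hence `CharZero k`, and the bound is the instance-form fact
`sq_le_two_mul_determinantalComplexity_perPoly_charZero_holds` (valid for every `n`). The proof
lives here rather than next to the fact because the Hessian argument (`MignonRessayreBound.lean`)
imports `PermanentVsDeterminant.lean`. [cite: MignonRessayre2004, Thm. 1.1] -/
theorem sq_le_two_mul_determinantalComplexity_perPoly_holds :
    sq_le_two_mul_determinantalComplexity_perPoly := by
  intro k _ hk n _
  haveI : CharZero k := by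
    haveI : CharP k 0 := ringChar.eq_iff.1 hk
    exact CharP.charP_to_charZero k
  exact sq_le_two_mul_determinantalComplexity_perPoly_charZero_holds k n

end CharZero

end Literature.Computability.AlgebraicComplexity
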